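import Mathlib
import HarnessLib
import Summits.Ventures.LatticeQCDFlow.Scoring.ChainEDFBand
import Summits.Ventures.LatticeQCDFlow.Scoring.SampleQuantileStdErr

/-!
# The QUANTILE DENSITY `1/f(q)` is consistently estimated from the output of a DOEBLIN CHAIN,
# from any start: the spacing estimator `ŝ_N = (q̂_N(u + h_N) − q̂_N(u − h_N))/(2h_N)` of the first
# `N` states converges in probability to `1/f` when `h_N → 0`, `N·h_N² → ∞`

HONEST FRAMING: exact (Metropolis-corrected) sampling algorithms for lattice gauge theory;
figures of merit are autocorrelation/cost numbers at stated couplings and volumes; no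
continuum-physics claim.

Venture `LatticeQCDFlow` (cell pub-lqcd), topic `Scoring`; FANOUT row 4 (`s0-u1-b`, rung S0-B).
`Scoring/SampleQuantileStdErr` proved the Siddiqui–Bloch–Gastwirth spacing estimator consistent
for INDEPENDENT draws; the error bar of a percentile printed from a Markov-chain sampler is
`σ_q/(f(q)√N)` with `σ_q²` the Green–Kubo (integrated-autocorrelation) variance of the indicator
`1{O ≤ q}` (row 8's `Scoring/MarkovChainCLT`) — the factor `1/f(q)` is the same quantile density,
and this file shows that the same spacing estimator recovers it from the CHAIN output, from any
start: **`chain_quantileSpacing_tendstoInMeasure`** — `π` invariant for `κ`, `κ(x, ·) ≥ ε π`,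
`O` a measurable real statistic whose stationary distribution function `F_π` has `F_π(q) = u ∈
(0,1)` and derivative `f > 0` at `q`; bandwidth `h_N > 0`, `h_N → 0`, `N·h_N² → ∞`; then under the
trajectory law from ANY initial law the spacing estimator of the first `N` states converges in
probability to `1/f`.  The proof is that of the iid file with the four Hoeffding events replaced by
the four one-point chain tails (`ChainEDFBand.chain_measureReal_cdf_sub_edf_ge_le` and
its companion `chain_measureReal_edf_sub_cdf_ge_le` proved here), available once
`N·δh_N/2 ≥ 8/ε` — eventually, because `N·h_N → ∞` — with total failure probability
`≤ 4·exp(−N δ² h_N² ε²/512)` eventually; the deterministic core is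
`SampleQuantileStdErr.abs_spacing_sub_inv_lt_of_deviations`.
**`indepMH_quantileSpacing_tendstoInMeasure`**: the exact flow sampler `indepMH q w`, `w ≤ M`.
NEW WORK of the cell (not a published result); no definition is introduced.

## Content

* `tendsto_mul_bandwidth_atTop` — `N·h_N² → ∞`, `h_N → 0` ⇒ `N·h_N → ∞`;
* `chain_measureReal_edf_sub_cdf_ge_le` — the one-point upper tail for `≤` along the chain;
* **`chain_quantileSpacing_tendstoInMeasure`**, **`indepMH_quantileSpacing_tendstoInMeasure`**.

NOT CLAIMED: the Green–Kubo factor `σ_q` (this file estimates `1/f` only); the weaker bandwidth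
condition `N·h_N → ∞`; a rate; any `ε` for a concrete sampler.
-/

noncomputable section

namespace Summit.Ventures.LatticeQCDFlow.Scoring.GlivenkoCantelli

open MeasureTheory ProbabilityTheory Finset Filter Function
open scoped Topology ENNReal

/-- `h_N > 0`, `h_N → 0`, `N·h_N² → ∞` ⇒ `N·h_N → ∞`. [folklore] -/
theorem tendsto_mul_bandwidth_atTop {h : ℕ → ℝ} (hh0 : ∀ n, 0 < h n)
    (hh : Tendsto h atTop (𝓝 0)) (hnh : Tendsto (fun n : ℕ => (n : ℝ) * h n ^ 2) atTop atTop) :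
    Tendsto (fun n : ℕ => (n : ℝ) * h n) atTop atTop := by
  refine tendsto_atTop_mono' atTop ?_ hnh
  filter_upwards [hh.eventually (gt_mem_nhds zero_lt_one)] with n hn
  have h1 : h n ^ 2 ≤ h n := by nlinarith [hh0 n]
  exact mul_le_mul_of_nonneg_left h1 (Nat.cast_nonneg n)

variable {Ω : Type*} [MeasurableSpace Ω]
variable {κ : Kernel Ω Ω} [IsMarkovKernel κ] {μ₀ : Measure Ω} [IsProbabilityMeasure μ₀]
  {π : Measure Ω} [IsProbabilityMeasure π]

/-- **Upper deviation of the chain's empirical distribution function at a point.**  `π`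
invariant for `κ`, `κ(x, ·) ≥ ε π` (`ε > 0`), `O` measurable, `F_π = cdf (π ∘ O⁻¹)`; `N ≠ 0`,
`Nδ ≥ 8/ε`.  From any initial law,
`P_{μ₀}(δ ≤ #{i<N : O(X_i) ≤ t}/N − F_π(t)) ≤ exp(−(Nδ − 8/ε)²/(32N/ε²))`. [ours] (the companion
of `ChainEDFBand.chain_measureReal_cdf_sub_edf_ge_le`: row 8's `chain_tail_le_exp_of_doeblin` for
`f = 1{O ≤ t}` with `|f| ≤ 2 − |πf|`) -/
theorem chain_measureReal_edf_sub_cdf_ge_le (hπ : Kernel.Invariant κ π) {ε : ℝ≥0∞}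
    (hmin : ∀ x {B : Set Ω}, MeasurableSet B → ε * π B ≤ κ x B) (hε0 : 0 < ε)
    {O : Ω → ℝ} (hO : Measurable O) (t : ℝ) {N : ℕ} (hN : N ≠ 0) {δ : ℝ}
    (hδ : 8 / ε.toReal ≤ N * δ) :
    (Kernel.trajMeasure (X := fun _ : ℕ => Ω) μ₀
          (fun m : ℕ => κ.comap (fun y : (i : ↥(Finset.Iic m)) → Ω => y ⟨m, Finset.mem_Iic.2 le_rfl⟩)
            (measurable_pi_apply _))).real
        {x | δ ≤ (∑ i ∈ range N, (Set.Iic t).indicator (1 : ℝ → ℝ) (O (x i))) / N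
            - cdf (π.map O) t}
      ≤ Real.exp (-(N * δ - 8 / ε.toReal) ^ 2 / (32 * N / ε.toReal ^ 2)) := by
  haveI : IsProbabilityMeasure (π.map O) := Measure.isProbabilityMeasure_map hO.aemeasurable
  have hIm : Measurable ((Set.Iic t).indicator (1 : ℝ → ℝ)) :=
    measurable_one.indicator measurableSet_Iic
  have hfm : Measurable (fun z => (Set.Iic t).indicator (1 : ℝ → ℝ) (O z)) := hIm.comp hO
  have hint : ∫ z, (Set.Iic t).indicator (1 : ℝ → ℝ) (O z) ∂π = cdf (π.map O) t := by
    rw [← integral_map hO.aemeasurable hIm.aestronglyMeasurable,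
      integral_indicator_one measurableSet_Iic, cdf_eq_real]
  have hF0 : 0 ≤ cdf (π.map O) t := cdf_nonneg _ _
  have hF1 : cdf (π.map O) t ≤ 1 := cdf_le_one _ _
  have hC : ∀ z, |(Set.Iic t).indicator (1 : ℝ → ℝ) (O z)|
      ≤ 2 - |∫ z, (Set.Iic t).indicator (1 : ℝ → ℝ) (O z) ∂π| := by
    intro z
    rw [hint, abs_of_nonneg (indicator_one_nonneg _ _), abs_of_nonneg hF0]
    linarith [indicator_one_le_one (Set.Iic t) (O z)]
  have h42 : (4 : ℝ) * 2 = 8 := by norm_num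
  have hs : 4 * ((2 - |∫ z, (Set.Iic t).indicator (1 : ℝ → ℝ) (O z) ∂π|)
      + |∫ z, (Set.Iic t).indicator (1 : ℝ → ℝ) (O z) ∂π|) / ε.toReal ≤ N * δ := by
    rw [sub_add_cancel, h42]
    exact hδ
  have h := chain_tail_le_exp_of_doeblin (μ₀ := μ₀) hπ hmin hε0 hfm hC hN hs
  beta_reduce at h
  rw [sub_add_cancel, h42, hint] at h
  refine h.trans (le_of_eq ?_)
  congr 1
  ring

/-- **THE SPACING ESTIMATOR OF THE QUANTILE DENSITY IS CONSISTENT ALONG A DOEBLIN CHAIN, FROM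
ANY START.**  `π` invariant for `κ`, `κ(x, ·) ≥ ε π` (`ε > 0`); `O` a measurable real statistic,
`F_π = cdf (π ∘ O⁻¹)` with `F_π(q) = u ∈ (0,1)` and derivative `f > 0` at `q`; bandwidth
`h_N > 0`, `h_N → 0`, `N·h_N² → ∞`.  With the empirical quantiles of the first `N` states,
`q̂_N(v) = inf{x : v ≤ #{i<N : O(X_i) ≤ x}/N}`, under the trajectory law from any initial law
`μ₀`: `(q̂_N(u + h_N) − q̂_N(u − h_N))/(2h_N) → 1/f` in probability. [ours] -/
theorem chain_quantileSpacing_tendstoInMeasure (hπ : Kernel.Invariant κ π) {ε : ℝ≥0∞}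
    (hmin : ∀ x {B : Set Ω}, MeasurableSet B → ε * π B ≤ κ x B) (hε0 : 0 < ε)
    {O : Ω → ℝ} (hO : Measurable O) {u q f : ℝ} (hu0 : 0 < u) (hu1 : u < 1)
    (hFq : cdf (π.map O) q = u) (hder : HasDerivAt (cdf (π.map O)) f q) (hf : 0 < f)
    {h : ℕ → ℝ} (hh0 : ∀ n, 0 < h n) (hh : Tendsto h atTop (𝓝 0))
    (hnh : Tendsto (fun n : ℕ => (n : ℝ) * h n ^ 2) atTop atTop) :
    TendstoInMeasure (Kernel.trajMeasure (X := fun _ : ℕ => Ω) μ₀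
          (fun m : ℕ => κ.comap (fun y : (i : ↥(Finset.Iic m)) → Ω => y ⟨m, Finset.mem_Iic.2 le_rfl⟩)
            (measurable_pi_apply _)))
      (fun (N : ℕ) (x : ℕ → Ω) =>
        (sInf {t | u + h N ≤ (∑ i ∈ range N, (Set.Iic t).indicator (1 : ℝ → ℝ) (O (x i))) / N}
          - sInf {t | u - h N ≤ (∑ i ∈ range N, (Set.Iic t).indicator (1 : ℝ → ℝ) (O (x i))) / N})
          / (2 * h N)) atTop (fun _ => 1 / f) := by
  set P := Kernel.trajMeasure (X := fun _ : ℕ => Ω) μ₀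
      (fun m : ℕ => κ.comap (fun y : (i : ↥(Finset.Iic m)) → Ω => y ⟨m, Finset.mem_Iic.2 le_rfl⟩)
        (measurable_pi_apply _)) with hP
  obtain ⟨-, -, -, -, -, he⟩ := half_const_bounds hmin hε0
  set e : ℝ := ε.toReal with hedef
  rw [tendstoInMeasure_iff_norm]
  intro η hη
  -- the relative precision `δ`
  set δ : ℝ := min (1 / 2) (η * f) with hδdef
  have hδ0 : 0 < δ := lt_min (by norm_num) (mul_pos hη hf)
  have hδ1 : δ ≤ 1 / 2 := min_le_left _ _
  have hδη : δ / f ≤ η := by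
    rw [div_le_iff₀ hf]
    exact min_le_right _ _
  have hf0 : f ≠ 0 := hf.ne'
  -- first-order expansion of `F_π` at the points `q + (c/f)·h_N`, `|c| ≤ 2`
  have hexp : ∀ c : ℝ, |c| ≤ 2 → ∀ᶠ n in atTop,
      |cdf (π.map O) (q + c / f * h n) - u - c * h n| ≤ δ * h n / 4 := by
    intro c hc
    have hlo := (hasDerivAt_iff_isLittleO.1 hder).def (show (0 : ℝ) < δ * f / 8 by positivity)
    have htend : Tendsto (fun n => q + c / f * h n) atTop (𝓝 q) := by
      simpa using (hh.const_mul (c / f)).const_add q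
    filter_upwards [htend.eventually hlo] with n hn
    rw [hFq] at hn
    simp only [smul_eq_mul, add_sub_cancel_left, Real.norm_eq_abs] at hn
    have e1 : c / f * h n * f = c * h n := by field_simp
    rw [e1] at hn
    have hhn : 0 < h n := hh0 n
    calc |cdf (π.map O) (q + c / f * h n) - u - c * h n|
        ≤ δ * f / 8 * |c / f * h n| := hn
      _ = δ * h n / 8 * |c| := by
          rw [abs_mul, abs_div, abs_of_pos hf, abs_of_pos hhn]
          field_simp
      _ ≤ δ * h n / 8 * 2 := mul_le_mul_of_nonneg_left hc (by positivity)
      _ = δ * h n / 4 := by ring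
  have hc1 : |1 + δ| ≤ 2 := by rw [abs_of_pos (by linarith)]; linarith
  have hc2 : |1 - δ| ≤ 2 := by rw [abs_of_pos (by linarith)]; linarith
  have hc3 : |-(1 - δ)| ≤ 2 := by rw [abs_neg]; exact hc2
  have hc4 : |-(1 + δ)| ≤ 2 := by rw [abs_neg]; exact hc1
  -- the levels `u ± h_N` are eventually inside `(0,1)`; the run is eventually long enough
  have hlev : ∀ᶠ n in atTop, h n < min u (1 - u) :=
    hh.eventually (gt_mem_nhds (lt_min hu0 (by linarith)))
  have hlong : ∀ᶠ n : ℕ in atTop, 16 / e ≤ (n : ℝ) * h n * (δ / 2) :=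
    ((tendsto_mul_bandwidth_atTop hh0 hh hnh).atTop_mul_const (by positivity : (0 : ℝ) < δ / 2))
      |>.eventually_ge_atTop _
  -- the bound on the bad event, for large `N`
  have hbound : ∀ᶠ n : ℕ in atTop,
      P.real {x | η ≤ ‖(sInf {t | u + h n ≤
            (∑ i ∈ range n, (Set.Iic t).indicator (1 : ℝ → ℝ) (O (x i))) / n}
          - sInf {t | u - h n ≤
            (∑ i ∈ range n, (Set.Iic t).indicator (1 : ℝ → ℝ) (O (x i))) / n}) / (2 * h n)
          - 1 / f‖}
        ≤ 4 * Real.exp (-((n : ℝ) * h n ^ 2 * (δ ^ 2 * e ^ 2 / 512))) := by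
    filter_upwards [hexp (1 + δ) hc1, hexp (1 - δ) hc2, hexp (-(1 - δ)) hc3, hexp (-(1 + δ)) hc4,
      hlev, eventually_ge_atTop 1, hlong] with n h1 h2 h3 h4 h5 h6 h7
    have hhn : 0 < h n := hh0 n
    have h5a : h n < u := lt_of_lt_of_le h5 (min_le_left _ _)
    have h5b : h n < 1 - u := lt_of_lt_of_le h5 (min_le_right _ _)
    have hn0 : n ≠ 0 := by omega
    have hNpos : (0 : ℝ) < n := by exact_mod_cast h6
    have hs : 8 / e ≤ n * (δ * h n / 2) := by
      have : (8 : ℝ) / e ≤ 16 / e := by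
        rw [div_le_div_iff_of_pos_right he]; norm_num
      linarith
    -- the four one-point chain tails
    have HB1 := chain_measureReal_cdf_sub_edf_ge_le (μ₀ := μ₀) hπ hmin hε0 hO
      (q + (1 + δ) / f * h n) hn0 hs
    have HB2 := chain_measureReal_edf_sub_cdf_ge_le (μ₀ := μ₀) hπ hmin hε0 hO
      (q + (1 - δ) / f * h n) hn0 hs
    have HB3 := chain_measureReal_cdf_sub_edf_ge_le (μ₀ := μ₀) hπ hmin hε0 hO
      (q + -(1 - δ) / f * h n) hn0 hs
    have HB4 := chain_measureReal_edf_sub_cdf_ge_le (μ₀ := μ₀) hπ hmin hε0 hO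
      (q + -(1 + δ) / f * h n) hn0 hs
    rw [← hP] at HB1 HB2 HB3 HB4
    -- the chain tail is below the Gaussian-in-`N h_N²` envelope
    have htail : Real.exp (-(n * (δ * h n / 2) - 8 / e) ^ 2 / (32 * n / e ^ 2))
        ≤ Real.exp (-((n : ℝ) * h n ^ 2 * (δ ^ 2 * e ^ 2 / 512))) := by
      refine Real.exp_le_exp.2 ?_
      have hden : (0 : ℝ) < 32 * n / e ^ 2 := by positivity
      have hhalf : n * (δ * h n / 2) / 2 ≤ n * (δ * h n / 2) - 8 / e := by
        have : (16 : ℝ) / e = 2 * (8 / e) := by ring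
        nlinarith
      have hsq : (n * (δ * h n / 2) / 2) ^ 2 ≤ (n * (δ * h n / 2) - 8 / e) ^ 2 :=
        pow_le_pow_left₀ (by positivity) hhalf 2
      have hkey : (n : ℝ) * h n ^ 2 * (δ ^ 2 * e ^ 2 / 512) * (32 * n / e ^ 2)
          = (n * (δ * h n / 2) / 2) ^ 2 := by
        field_simp
        ring
      rw [neg_div, neg_le_neg_iff, le_div_iff₀ hden, hkey]
      exact hsq
    -- outside the four events the estimator is `η`-close to `1/f`
    set B1 : Set (ℕ → Ω) := {x | δ * h n / 2 ≤ cdf (π.map O) (q + (1 + δ) / f * h n)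
        - (∑ i ∈ range n, (Set.Iic (q + (1 + δ) / f * h n)).indicator (1 : ℝ → ℝ)
            (O (x i))) / n} with hB1
    set B2 : Set (ℕ → Ω) := {x | δ * h n / 2 ≤ (∑ i ∈ range n,
          (Set.Iic (q + (1 - δ) / f * h n)).indicator (1 : ℝ → ℝ) (O (x i))) / n
        - cdf (π.map O) (q + (1 - δ) / f * h n)} with hB2
    set B3 : Set (ℕ → Ω) := {x | δ * h n / 2 ≤ cdf (π.map O) (q + -(1 - δ) / f * h n)
        - (∑ i ∈ range n, (Set.Iic (q + -(1 - δ) / f * h n)).indicator (1 : ℝ → ℝ)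
            (O (x i))) / n} with hB3
    set B4 : Set (ℕ → Ω) := {x | δ * h n / 2 ≤ (∑ i ∈ range n,
          (Set.Iic (q + -(1 + δ) / f * h n)).indicator (1 : ℝ → ℝ) (O (x i))) / n
        - cdf (π.map O) (q + -(1 + δ) / f * h n)} with hB4
    have hincl : {x : ℕ → Ω | η ≤ ‖(sInf {t | u + h n ≤
            (∑ i ∈ range n, (Set.Iic t).indicator (1 : ℝ → ℝ) (O (x i))) / n}
          - sInf {t | u - h n ≤
            (∑ i ∈ range n, (Set.Iic t).indicator (1 : ℝ → ℝ) (O (x i))) / n}) / (2 * h n)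
          - 1 / f‖} ⊆ ((B1 ∪ B2) ∪ B3) ∪ B4 := by
      intro x hx
      by_contra hnot
      simp only [Set.mem_union, not_or, hB1, hB2, hB3, hB4, Set.mem_setOf_eq, not_le] at hnot
      obtain ⟨⟨⟨g1, g2⟩, g3⟩, g4⟩ := hnot
      rw [Set.mem_setOf_eq, Real.norm_eq_abs] at hx
      exact absurd hx (not_le.2 (abs_spacing_sub_inv_lt_of_deviations (fun i => O (x i)) h6
        (cdf (π.map O)) hhn hδ0 hδη (by linarith) (by linarith) h1 h2 h3 h4 g1 g2 g3 g4))
    have hU := measureReal_mono hincl (measure_ne_top P _)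
    have u1 := measureReal_union_le (μ := P) ((B1 ∪ B2) ∪ B3) B4
    have u2 := measureReal_union_le (μ := P) (B1 ∪ B2) B3
    have u3 := measureReal_union_le (μ := P) B1 B2
    linarith
  -- the envelope tends to zero
  have hlim : Tendsto (fun n : ℕ => 4 * Real.exp (-((n : ℝ) * h n ^ 2 * (δ ^ 2 * e ^ 2 / 512))))
      atTop (𝓝 0) := by
    have hg : Tendsto (fun n : ℕ => (n : ℝ) * h n ^ 2 * (δ ^ 2 * e ^ 2 / 512)) atTop atTop :=
      hnh.atTop_mul_const (by positivity)
    have := (Real.tendsto_exp_neg_atTop_nhds_zero.comp hg).const_mul 4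
    simpa using this
  have hreal := squeeze_zero' (Eventually.of_forall fun n => measureReal_nonneg) hbound hlim
  have := ENNReal.tendsto_ofReal hreal
  rw [ENNReal.ofReal_zero] at this
  refine this.congr' (Eventually.of_forall fun n => ?_)
  exact ofReal_measureReal (measure_ne_top _ _)

/-! ## The exact flow sampler under a weight ceiling -/

section FlowSampler

open Summit.Ventures.LatticeQCDFlow.Exactness

/-- **QUANTILE-DENSITY ESTIMATION FROM AN EXACT FLOW SAMPLER, FROM ANY START.**  Model law `q₀`
(the flow's output), weight `w = dπ/dq₀` measurable, `0 < w ≤ M`, `π = w · q₀` a probability law,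
`K = indepMH q₀ w`; `O` measurable with `F_π(q) = u ∈ (0,1)`, `F_π′(q) = f > 0`; bandwidth as
above.  Then the spacing estimator of the first `N` states converges in probability to `1/f`, for
every initial law. [ours] -/
theorem indepMH_quantileSpacing_tendstoInMeasure {q₀ : Measure Ω} [IsProbabilityMeasure q₀]
    {w : Ω → ℝ} [hwF : Fact (Measurable w)] (hw0 : ∀ x, 0 < w x) {M : ℝ} (hM : ∀ x, w x ≤ M)
    [IsProbabilityMeasure (q₀.withDensity fun y => ENNReal.ofReal (w y))]
    {O : Ω → ℝ} (hO : Measurable O) {u q f : ℝ} (hu0 : 0 < u) (hu1 : u < 1)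
    (hFq : cdf ((q₀.withDensity fun y => ENNReal.ofReal (w y)).map O) q = u)
    (hder : HasDerivAt (cdf ((q₀.withDensity fun y => ENNReal.ofReal (w y)).map O)) f q)
    (hf : 0 < f) {h : ℕ → ℝ} (hh0 : ∀ n, 0 < h n) (hh : Tendsto h atTop (𝓝 0))
    (hnh : Tendsto (fun n : ℕ => (n : ℝ) * h n ^ 2) atTop atTop) :
    TendstoInMeasure (Kernel.trajMeasure (X := fun _ : ℕ => Ω) μ₀
          (fun m : ℕ => (indepMH q₀ w).comap
            (fun y : (i : ↥(Finset.Iic m)) → Ω => y ⟨m, Finset.mem_Iic.2 le_rfl⟩)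
            (measurable_pi_apply _)))
      (fun (N : ℕ) (x : ℕ → Ω) =>
        (sInf {t | u + h N ≤ (∑ i ∈ range N, (Set.Iic t).indicator (1 : ℝ → ℝ) (O (x i))) / N}
          - sInf {t | u - h N ≤ (∑ i ∈ range N, (Set.Iic t).indicator (1 : ℝ → ℝ) (O (x i))) / N})
          / (2 * h N)) atTop (fun _ => 1 / f) := by
  have hw : Measurable w := hwF.out
  have hinv := indepMH_invariant (q := q₀) hw hw0
  have hmin : ∀ x {B : Set Ω}, MeasurableSet B →
      (ENNReal.ofReal M)⁻¹ * (q₀.withDensity fun y => ENNReal.ofReal (w y)) B ≤ indepMH q₀ w x B :=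
    fun x B hB => indepMH_apply_ge (q := q₀) hw hw0 hM x hB
  have hε0 : 0 < (ENNReal.ofReal M)⁻¹ := ENNReal.inv_pos.2 ENNReal.ofReal_ne_top
  exact chain_quantileSpacing_tendstoInMeasure (μ₀ := μ₀) hinv hmin hε0 hO hu0 hu1 hFq hder hf
    hh0 hh hnh

end FlowSampler

end Summit.Ventures.LatticeQCDFlow.Scoring.GlivenkoCantelli

end
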